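import Summits.QuantumFields.YangMills.Theorems.AlphaInputsT3ACv4SmallFactor71OfRec
import HarnessLib

/-!
# `AlphaInputsT3ACv4SeamWindow` — THE (71)_sym SEAM ROW'S THREE WINDOW NUMERALS FOLDED INTO ONE RECORD ROW ON `γ₀`: `SmallFactor71OfRecT3` at EVERY coupling of the record's
# window from `5 ≤ L` and `γ₀ ≤ (σ₇₁(L, C68)/(b₀Q₀(p₀)))⁴` — def-free, generic in the window coefficients — lane `pub-balaban3d`, width seat alpha-2 (g7)

WHY (cell `ym3-torus`, route `UnitScaleTilt`, crux `HistoryTailL` = stmt-QuantumFields-19936, stub 2′χ-v4 `AlphaInputsT3ACv4RecChi`).  ✓ `…v4RecordSelXs` (this seat, P4) displays per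
family the seam row `AlphaInputsT3AC.SmallFactor71OfRecT3 F 𝔠 γ hγ hγ1 K`; ★w2-19936 g4's ✓ `…v4SmallFactor71OfRec` (`smallFactor71OfRecT3_of_windows`) discharges it from `5 ≤ F.L`
and, at every `j < K`, the numerals `648000·L·C68·ε₁(j) ≤ 1`, `ε₁(j) ≤ 1`, `½(2C68·C₂(L) + C₂(L)²)·ε₁(j) ≤ ¼` (`C₂(L) = (207360000·L + 1331529∕4)·C68²`, `ε₁(j) = eps1Of … j`).
At the T³ scales `ε₁(j) = θBal L γ b₀ p₀ (K − j) = g·p(g)` at `g = √(γL^{−(K−j)})` (§1), and [Balaban1985UV3] (7)'s threshold function obeys `θBal ≤ σ` at EVERY distance once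
`γ ≤ (σ/(b₀Q₀(p₀)))⁴` (`T3Thresholds.θBal_le_of_le_gamma`); every coupling of the record's window is `≤ γ₀` (`MinimiserPin.le_gamma0_of_window`).  So ONE record row on the
record's OWN constant `γ₀` — chosen after `b₀, p₀` (and `C68`) — folds all three numerals (§2–§3):
* §1 `AlphaInputsT3AC.eps1Of_T3Scales_eq` (`ε₁(j) = θBal(K − j)`, package-free) and `MinimiserPin.θBal_le_of_gamma0_le` (`γ₀ ≤ (σ/(b₀Q₀))⁴ ⇒ θBal ≤ σ` on the whole window);
* §2 ★ `AlphaInputsT3AC.windows71_of_gamma0` — GENERIC in the two window coefficients `a, c ≥ 0` (so the SEAM-L3 `_allL` re-derivation of the numerals re-uses it): `γ₀ ≤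
  ((a + 2c + 1)⁻¹/(b₀Q₀))⁴` ⟹ at every `(γ, K)` of the window and every `j < K`: `a·ε₁(j) ≤ 1`, `ε₁(j) ≤ 1`, `½c·ε₁(j) ≤ ¼`; ★ `AlphaInputsT3AC.smallFactor71OfRecT3_of_gamma0` — today's
  numerals (`a = 648000·L·C68`, `c = 2C68·C₂(L) + C₂(L)²`): `5 ≤ F.L` ∧ the `γ₀`-row ⟹ `SmallFactor71OfRecT3 F 𝔠 γ hγ hγ1 K` at EVERY `(γ, K)`; and its record-level transport
  `smallFactor71OfRecT3_of_gamma0_cast` (row stated with `L`, family `F` with `F.L = L`) — the form a display with the seam conjunct replaced by the `γ₀`-row consumes (def-free file: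
  the display twin waits for the final, L-free numerals of LF-2's SEAM-L3 closure, ★★OWNER RULING g26-№20).
WHY NOT a `C68`-row (like the record's `hCe`∕`hCa`): the built-in window `γ₀ ≤ (3C₀(3)·C68·b₀Q₀)⁻²` would need `b₀Q₀(p₀)·D² ≤ 3C₀(3)·C68`, unsatisfiable for large profiles
`(b₀, p₀)` (`Q₀` grows super-exponentially, `D` grows with `C68`); the `γ₀`-row has no such obstruction.
HONEST FRAMING.  Bookkeeping of landed theorems; L-FLOOR (RULING g26-№20): `smallFactor71OfRecT3_of_gamma0` carries `5 ≤ F.L` because ★w2's `smallFactor71OfRecT3_of_windows` does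
(consumed only in `EMLIterUniform.step_dominates`, LF-2, COSMETIC+, closing by SEAM-L3); the window numerals themselves carry NO floor; (O‴χₛ), NODE O's rows, the stub and the crux are NOT proved; count-neutral helper (`--supports stmt-QuantumFields-19936`); registry untouched.  YM₃ on the three-torus is
rung R3 of the programme, NOT the Clay problem: nothing here bears on d = 4, infinite volume, or a mass gap.

References: T. Bałaban, Commun. Math. Phys. 102 (1985) 255–275 [Balaban1985UV3] ((3) p.256, (7) p.257, (67)–(71) p.273); Commun. Math. Phys. 102 (1985) 277–309
[Balaban1985Variational] (Thm 1 (6)–(8) pp.278–279).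
-/

set_option autoImplicit false

noncomputable section

namespace Summit.QuantumFields.YangMills.Theorems

open Literature.MathematicalPhysics.QuantumFieldTheory.Balaban1983to89
open Literature.MathematicalPhysics.QuantumFieldTheory.Balaban1983to89.T3ContinuumYM3Torus
open Literature.MathematicalPhysics.QuantumFieldTheory.Balaban1983to89.T3UnitScaleTilt (θBal)
open Literature.MathematicalPhysics.QuantumFieldTheory.Balaban1983to89.T3PrintedMinimiserExistence (Thm1GlobalMinAt)
open Literature.MathematicalPhysics.QuantumFieldTheory.Balaban1983to89.ExpMeanLog (deltaSU)
open Literature.MathematicalPhysics.QuantumFieldTheory.Balaban1985CMP102.Setting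
open Summit.QuantumFields.Balaban3D.Carriers
open Summit.QuantumFields.Balaban3D.Proofs.Primitives (AlphaConsts)
open Summit.QuantumFields.Balaban3D.Proofs.Thresholds (Q0 Q0_pos)
open B7Prop2Explicit (C0 C0_pos)

/-! ## §1 `ε₁(j) = θBal(K − j)` at the T³ scales, and `θBal ≤ σ` on the whole window from a `γ₀`-row -/

section Window

variable {F : T3Family} {𝔠 : AlphaConsts F.L (suGroupModel 2).N} {γ : ℝ} {hγ : 0 < γ} {hγ1 : γ ≤ (min 𝔠.gamma0 1) ^ 2}

/-- **`ε₁(j) = g_j p(g_j) = θBal L γ b₀ p₀ (K − j)` for `j ≤ K` at the T³ scales** (package-free form of `PkgCoreRows.eps1_eq`). [cite: Balaban1985UV3, (3) p.256 and (7) p.257] -/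
theorem AlphaInputsT3AC.eps1Of_T3Scales_eq (K j : ℕ) (hj : j ≤ K) :
    eps1Of (T3Scales F γ hγ (hγ1.trans (sq_min_one_le _ 𝔠.gamma0_pos)) K) 𝔠.lane.carrier j = θBal F.L γ 𝔠.b₀ 𝔠.p₀ (K - j) := by
  show (T3Scales F γ hγ (hγ1.trans (sq_min_one_le _ 𝔠.gamma0_pos)) K).gk j *
      B10.pFun 𝔠.b₀ 𝔠.p₀ ((T3Scales F γ hγ (hγ1.trans (sq_min_one_le _ 𝔠.gamma0_pos)) K).gk j) = _
  rw [T3Scales_gk_eq F γ hγ _ K j hj]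
  rfl

end Window

/-- **`θBal ≤ σ` AT EVERY DISTANCE AND EVERY COUPLING OF THE RECORD'S WINDOW FROM ONE ROW ON `γ₀`**: `γ₀ ≤ (σ/(b₀Q₀(p₀)))⁴` ⟹ `θBal L γ b₀ p₀ n ≤ σ` for all `0 < γ ≤ (min γ₀ 1)²`
and all `n` (`le_gamma0_of_window` + `T3Thresholds.θBal_le_of_le_gamma`). [cite: Balaban1985UV3, (7) p.257] -/
theorem MinimiserPin.θBal_le_of_gamma0_le {L : ℕ} (𝔠 : AlphaConsts L (suGroupModel 2).N) (hL : 1 ≤ L) {σ : ℝ} (hσ : 0 ≤ σ)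
    (hg : 𝔠.gamma0 ≤ ((σ / (𝔠.b₀ * Q0 𝔠.p₀)) ^ 2) ^ 2) :
    ∀ γ : ℝ, 0 < γ → γ ≤ (min 𝔠.gamma0 1) ^ 2 → ∀ n : ℕ, θBal L γ 𝔠.b₀ 𝔠.p₀ n ≤ σ := by
  intro γ hγ hγ1 n
  have hγ1' : γ ≤ 1 := hγ1.trans (sq_min_one_le _ 𝔠.gamma0_pos)
  exact T3Thresholds.θBal_le_of_le_gamma hL 𝔠.b₀_pos 𝔠.p₀_pos hσ hγ hγ1' ((MinimiserPin.le_gamma0_of_window 𝔠 hγ1).trans hg) n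

/-! ## §2 The seam row at every coupling of the window from `5 ≤ L` and the `γ₀`-row -/

section Seam

variable {F : T3Family} {𝔠 : AlphaConsts F.L (suGroupModel 2).N}

/-- ★ **THE THREE (71) WINDOW NUMERALS AT EVERY `(γ, K, j)` OF THE RECORD'S WINDOW FROM ONE `γ₀`-ROW — GENERIC IN THE COEFFICIENTS.**  For `a, c ≥ 0` and `D := a + 2c + 1`:
`γ₀ ≤ ((D⁻¹/(b₀Q₀(p₀)))²)²` gives `θBal ≤ D⁻¹` on the whole window, hence `a·ε₁(j) ≤ a·D⁻¹ ≤ 1`, `ε₁(j) ≤ D⁻¹ ≤ 1`, `½c·ε₁(j) ≤ ½c·D⁻¹ ≤ ¼` (today `a = 648000·L·C68`,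
`c = 2C68·C₂(L) + C₂(L)²`; after LF-2's SEAM-L3 closure the L-free numerals). [cite: Balaban1985UV3, (7) p.257 and (67)–(71) p.273] -/
theorem AlphaInputsT3AC.windows71_of_gamma0 {a c : ℝ} (ha : 0 ≤ a) (hc : 0 ≤ c)
    (hg : 𝔠.gamma0 ≤ (((a + 2 * c + 1)⁻¹ / (𝔠.b₀ * Q0 𝔠.p₀)) ^ 2) ^ 2)
    (γ : ℝ) (hγ : 0 < γ) (hγ1 : γ ≤ (min 𝔠.gamma0 1) ^ 2) (K j : ℕ) (hj : j < K) :
    a * eps1Of (T3Scales F γ hγ (hγ1.trans (sq_min_one_le _ 𝔠.gamma0_pos)) K) 𝔠.lane.carrier j ≤ 1 ∧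
      eps1Of (T3Scales F γ hγ (hγ1.trans (sq_min_one_le _ 𝔠.gamma0_pos)) K) 𝔠.lane.carrier j ≤ 1 ∧
      c / 2 * eps1Of (T3Scales F γ hγ (hγ1.trans (sq_min_one_le _ 𝔠.gamma0_pos)) K) 𝔠.lane.carrier j ≤ 1 / 4 := by
  set D : ℝ := a + 2 * c + 1 with hD
  have hL1 : 1 ≤ F.L := le_of_lt F.hL.2
  have hD1 : 1 ≤ D := by rw [hD]; linarith
  have hD0 : 0 < D := lt_of_lt_of_le one_pos hD1
  -- `ε₁(j) = θBal(K − j) ≤ D⁻¹` on the whole window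
  have heps : eps1Of (T3Scales F γ hγ (hγ1.trans (sq_min_one_le _ 𝔠.gamma0_pos)) K) 𝔠.lane.carrier j ≤ D⁻¹ := by
    rw [AlphaInputsT3AC.eps1Of_T3Scales_eq (𝔠 := 𝔠) (hγ1 := hγ1) K j hj.le]
    exact MinimiserPin.θBal_le_of_gamma0_le 𝔠 hL1 (inv_nonneg.mpr hD0.le) hg γ hγ hγ1 (K - j)
  refine ⟨?_, heps.trans (inv_le_one_of_one_le₀ hD1), ?_⟩
  · calc a * eps1Of (T3Scales F γ hγ (hγ1.trans (sq_min_one_le _ 𝔠.gamma0_pos)) K) 𝔠.lane.carrier j ≤ a * D⁻¹ :=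
          mul_le_mul_of_nonneg_left heps ha
      _ ≤ 1 := by rw [mul_inv_le_iff₀ hD0, one_mul, hD]; linarith
  · calc c / 2 * eps1Of (T3Scales F γ hγ (hγ1.trans (sq_min_one_le _ 𝔠.gamma0_pos)) K) 𝔠.lane.carrier j ≤ c / 2 * D⁻¹ :=
          mul_le_mul_of_nonneg_left heps (by positivity)
      _ ≤ 1 / 4 := by rw [mul_inv_le_iff₀ hD0, hD]; linarith

/-- ★ **THE (71)_sym SEAM ROW AT EVERY `(γ, K)` OF THE RECORD'S WINDOW FROM `5 ≤ L` AND ONE `γ₀`-ROW** (today's numerals): with `C₂ = (207360000·L + 1331529∕4)·C68²` and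
`D = 648000·L·C68 + 2·(2C68·C₂ + C₂²) + 1`, `γ₀ ≤ ((D⁻¹/(b₀Q₀(p₀)))²)²` ⟹ `SmallFactor71OfRecT3 F 𝔠 γ hγ hγ1 K` (`windows71_of_gamma0` into ★w2-19936 g4's
`smallFactor71OfRecT3_of_windows`).  L-FLOOR: carries `5 ≤ F.L` because `smallFactor71OfRecT3_of_windows` does (LF-2). [cite: Balaban1985UV3, (7) p.257 and (67)–(71) p.273] -/
theorem AlphaInputsT3AC.smallFactor71OfRecT3_of_gamma0 (hL5 : 5 ≤ F.L)
    (hg : 𝔠.gamma0 ≤ (((648000 * (F.L : ℝ) * 𝔠.C68 +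
        2 * (2 * 𝔠.C68 * ((207360000 * (F.L : ℝ) + 1331529 / 4) * 𝔠.C68 ^ 2) + ((207360000 * (F.L : ℝ) + 1331529 / 4) * 𝔠.C68 ^ 2) ^ 2) + 1)⁻¹ /
        (𝔠.b₀ * Q0 𝔠.p₀)) ^ 2) ^ 2)
    (γ : ℝ) (hγ : 0 < γ) (hγ1 : γ ≤ (min 𝔠.gamma0 1) ^ 2) (K : ℕ) :
    AlphaInputsT3AC.SmallFactor71OfRecT3 F 𝔠 γ hγ hγ1 K := by
  have hC68 : 0 < 𝔠.C68 := 𝔠.C68_pos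
  have ha : (0 : ℝ) ≤ 648000 * (F.L : ℝ) * 𝔠.C68 := by positivity
  have hc : (0 : ℝ) ≤ 2 * 𝔠.C68 * ((207360000 * (F.L : ℝ) + 1331529 / 4) * 𝔠.C68 ^ 2) + ((207360000 * (F.L : ℝ) + 1331529 / 4) * 𝔠.C68 ^ 2) ^ 2 := by
    positivity
  exact AlphaInputsT3AC.smallFactor71OfRecT3_of_windows hL5
    (fun j hj => (AlphaInputsT3AC.windows71_of_gamma0 ha hc hg γ hγ hγ1 K j hj).1)
    (fun j hj => (AlphaInputsT3AC.windows71_of_gamma0 ha hc hg γ hγ hγ1 K j hj).2)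

end Seam

/-! ## §3 Record-level transport (the row stated with `L`, the family with `F.L = L`) -/

/-- At a family of block size `L ≥ 5`: the `γ₀`-row (stated with `L`) gives the seam row at every `(γ, K)` for the transported constants `hF ▸ 𝔠`.
[cite: Balaban1985UV3, (7) p.257 and (67)–(71) p.273] -/
theorem AlphaInputsT3AC.smallFactor71OfRecT3_of_gamma0_cast {L : ℕ} (hL5 : 5 ≤ L) {𝔠 : AlphaConsts L (suGroupModel 2).N}
    (hg : 𝔠.gamma0 ≤ (((648000 * (L : ℝ) * 𝔠.C68 +
        2 * (2 * 𝔠.C68 * ((207360000 * (L : ℝ) + 1331529 / 4) * 𝔠.C68 ^ 2) + ((207360000 * (L : ℝ) + 1331529 / 4) * 𝔠.C68 ^ 2) ^ 2) + 1)⁻¹ /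
        (𝔠.b₀ * Q0 𝔠.p₀)) ^ 2) ^ 2)
    (F : T3Family) (hF : F.L = L) :
    ∀ (γ : ℝ) (hγ : 0 < γ) (hγ1 : γ ≤ (min (hF ▸ 𝔠).gamma0 1) ^ 2) (K : ℕ), AlphaInputsT3AC.SmallFactor71OfRecT3 F (hF ▸ 𝔠) γ hγ hγ1 K := by
  subst hF
  exact fun γ hγ hγ1 K => AlphaInputsT3AC.smallFactor71OfRecT3_of_gamma0 hL5 hg γ hγ hγ1 K

end Summit.QuantumFields.YangMills.Theorems

end
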